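import Summits.Ventures.PercRepro.C041BlockMapCycle
import Summits.Ventures.PercRepro.C041MultiExitTwo
import Summits.Ventures.PercRepro.C041TriangleCone
import Summits.Ventures.PercRepro.C041CycleArcModel

/-!
# ROW C-041 — THE BLOCK MAP OF THE TRIANGLE HOST IS `θ_△`: the two formulations of the open core are one
statement, and the seed programme's target implies CONJECTURE (BLOCK MAP) for every two-exit cycle (p6, gen 36)

Setting of `C041BlockMapTriangleHosts` / `C041BlockMapCycle` (the triangle host `tri`, exits `triExit` at `1`
and `2`, anchor `0`; the cycles `cyc n₁ n₂ n₃`), `C041MultiExitTwo` (the two-exit block map as the sum over the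
colourings of `contrib` by the five statuses) and mine-3's `C041TriangleCone` (`thetaTri w w′ = Σ_{e₁ e₂ e₃}
triCol w w′ e₁ e₂ e₃`, the triangle map of C-041.md §21 (b) by the eight colourings).  THE STATUSES of the
triangle are decided: a vertex is joined to another by edges of colour `c` iff the direct edge has colour `c`
or the two other edges do (`TriConn`, `reflTransGen_tri_iff` — the closure of `TriConn` under one step and the
two-step path are finite checks, `decide`), whence `Mg` / `Rd` of the exits and the blue connection of the two
exits as Boolean formulas of the three edge colours (`tri_Mg_01`, …).  **THEOREM (`blockMap_tri`)**:
`blockMap tri triExit 0 w = thetaTri (w (inl ())) (w (inr ()))` — the block map of the triangle host at any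
inputs is mine-3's triangle map (the eight colouring terms agree one by one).  Hence `coneHost_tri_iff`:
CONJECTURE (BLOCK MAP) for the triangle ⟺ `θ_△` maps cone × cone into the cone; with THEOREM (CYCLE ⟸
TRIANGLE): `coneHost_cycle_of_thetaTri` and, through mine-3's reduction to pure inputs
(`InCone_thetaTri_of_pure`), `coneHost_cycle_of_thetaTri_pure` — the seed programme's statement for pure
inputs `V a`, `V b` gives CONJECTURE (BLOCK MAP) for every two-exit cycle, and (`inCone_sixVec_hang_cycle_of_pure`,
through THEOREM (BLOCK MAP, `r` EXITS)) the cone membership of the six-vector of every zone obtained by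
hanging two cone zones at the exits of any cycle.
-/

namespace PercRepro

namespace ZoneZ

namespace MultiExit

open ZoneData Pendant Finset TwoExit TreeClosure

/-! ## The colourings of the triangle -/

/-- A colouring of the three edges is the vector of its values. -/
theorem fin3_eta (ω : Fin 3 → Bool) : ω = ![ω 0, ω 1, ω 2] := by
  funext i
  fin_cases i <;> rfl

/-- The colourings of the triangle as triples. -/
def fin3Equiv : (Fin 3 → Bool) ≃ Bool × Bool × Bool where
  toFun ω := (ω 0, ω 1, ω 2)
  invFun p := ![p.1, p.2.1, p.2.2]
  left_inv ω := (fin3_eta ω).symm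
  right_inv p := by
    obtain ⟨b₀, b₁, b₂⟩ := p
    rfl

/-- The inverse of the triple bijection. -/
theorem fin3Equiv_symm_apply (b₀ b₁ b₂ : Bool) : fin3Equiv.symm (b₀, b₁, b₂) = ![b₀, b₁, b₂] := rfl

/-! ## The statuses of the triangle, decided -/

/-- `s` is joined to `v` by edges of colour `c` in the triangle: they are equal, or the direct edge has colour
`c`, or the two other edges do. -/
def TriConn (c : Bool) (ω : Fin 3 → Bool) (s v : Fin 3) : Prop :=
  s = v ∨ (∃ e, tri.Joins e s v ∧ ω e = c) ∨ (∀ e, ¬ tri.Joins e s v → ω e = c)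

/-- `TriConn` is closed under one step of the adjacency of colour `c` (a finite check). -/
theorem triConn_step (c : Bool) (ω : Fin 3 → Bool) (s x y : Fin 3) (h : TriConn c ω s x)
    (h' : cAdj tri c ω x y) : TriConn c ω s y := by
  have key : ∀ (c b₀ b₁ b₂ : Bool) (s x y : Fin 3), TriConn c ![b₀, b₁, b₂] s x →
      cAdj tri c ![b₀, b₁, b₂] x y → TriConn c ![b₀, b₁, b₂] s y := by
    intro c b₀ b₁ b₂
    unfold TriConn cAdj ZoneData.Joins
    cases c <;> cases b₀ <;> cases b₁ <;> cases b₂ <;> decide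
  rw [fin3_eta ω] at h h' ⊢
  exact key c (ω 0) (ω 1) (ω 2) s x y h h'

/-- When the two other edges have colour `c`, the third vertex is a path of colour `c` (a finite check). -/
theorem triConn_path (c : Bool) (ω : Fin 3 → Bool) (s v : Fin 3) (hsv : s ≠ v)
    (h : ∀ e, ¬ tri.Joins e s v → ω e = c) : ∃ t, cAdj tri c ω s t ∧ cAdj tri c ω t v := by
  have key : ∀ (c b₀ b₁ b₂ : Bool) (s v : Fin 3), s ≠ v → (∀ e, ¬ tri.Joins e s v → ![b₀, b₁, b₂] e = c) →
      ∃ t, cAdj tri c ![b₀, b₁, b₂] s t ∧ cAdj tri c ![b₀, b₁, b₂] t v := by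
    unfold cAdj ZoneData.Joins
    decide
  rw [fin3_eta ω] at h ⊢
  exact key c (ω 0) (ω 1) (ω 2) s v hsv h

/-- **The monochromatic paths of the triangle**: `s` reaches `v` by edges of colour `c` iff `TriConn c ω s v`. -/
theorem reflTransGen_tri_iff (c : Bool) (ω : Fin 3 → Bool) (s v : Fin 3) :
    Relation.ReflTransGen (cAdj tri c ω) s v ↔ TriConn c ω s v := by
  constructor
  · intro h
    induction h with
    | refl => exact Or.inl rfl
    | tail _ hstep ih => exact triConn_step c ω s _ _ ih hstep
  · rintro (rfl | ⟨e, he, hc⟩ | h)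
    · exact Relation.ReflTransGen.refl
    · exact Relation.ReflTransGen.single ⟨e, he, hc⟩
    · by_cases hsv : s = v
      · subst hsv
        exact Relation.ReflTransGen.refl
      · obtain ⟨t, h1, h2⟩ := triConn_path c ω s v hsv h
        exact (Relation.ReflTransGen.single h1).tail h2

/-- The exit `1` is merged iff the edge `0 → 1` is blue or the two other edges are. -/
theorem tri_Mg_01 (b₀ b₁ b₂ : Bool) : tri.Mg 0 1 ![b₀, b₁, b₂] ↔ (b₀ = false ∨ (b₁ = false ∧ b₂ = false)) := by
  rw [Mg_iff_reflTransGen, reflTransGen_tri_iff]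
  revert b₀ b₁ b₂
  unfold TriConn ZoneData.Joins
  decide

/-- The exit `2` is merged iff the edge `2 → 0` is blue or the two other edges are. -/
theorem tri_Mg_02 (b₀ b₁ b₂ : Bool) : tri.Mg 0 2 ![b₀, b₁, b₂] ↔ (b₂ = false ∨ (b₀ = false ∧ b₁ = false)) := by
  rw [Mg_iff_reflTransGen, reflTransGen_tri_iff]
  revert b₀ b₁ b₂
  unfold TriConn ZoneData.Joins
  decide

/-- The two exits are blue-connected iff the edge `1 → 2` is blue or the two other edges are. -/
theorem tri_Mg_12 (b₀ b₁ b₂ : Bool) : tri.Mg 1 2 ![b₀, b₁, b₂] ↔ (b₁ = false ∨ (b₀ = false ∧ b₂ = false)) := by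
  rw [Mg_iff_reflTransGen, reflTransGen_tri_iff]
  revert b₀ b₁ b₂
  unfold TriConn ZoneData.Joins
  decide

/-- The exit `1` is reached iff the edge `0 → 1` is red or the two other edges are. -/
theorem tri_Rd_01 (b₀ b₁ b₂ : Bool) : tri.Rd 0 1 ![b₀, b₁, b₂] ↔ (b₀ = true ∨ (b₁ = true ∧ b₂ = true)) := by
  rw [Rd_iff_reflTransGen, reflTransGen_tri_iff]
  revert b₀ b₁ b₂
  unfold TriConn ZoneData.Joins
  decide

/-- The exit `2` is reached iff the edge `2 → 0` is red or the two other edges are. -/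
theorem tri_Rd_02 (b₀ b₁ b₂ : Bool) : tri.Rd 0 2 ![b₀, b₁, b₂] ↔ (b₂ = true ∨ (b₀ = true ∧ b₁ = true)) := by
  rw [Rd_iff_reflTransGen, reflTransGen_tri_iff]
  revert b₀ b₁ b₂
  unfold TriConn ZoneData.Joins
  decide

/-! ## The exits of the triangle indexed by `Bool` -/

/-- `false ↦ inl ()`, `true ↦ inr ()`. -/
def boolEquivSum : Bool ≃ Unit ⊕ Unit where
  toFun b := if b then Sum.inr () else Sum.inl ()
  invFun := Sum.elim (fun _ => false) fun _ => true
  left_inv := by decide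
  right_inv := by decide

/-- The exit `false`. -/
theorem boolEquivSum_false : boolEquivSum false = Sum.inl () := rfl

/-- The exit `true`. -/
theorem boolEquivSum_true : boolEquivSum true = Sum.inr () := rfl

/-- The exits of the triangle re-indexed by `Bool` are `ex2 1 2`. -/
theorem triExit_comp : triExit ∘ boolEquivSum = ex2 1 2 := by
  funext b
  cases b <;> rfl

/-! ## THE BLOCK MAP OF THE TRIANGLE IS `θ_△` -/

/-- **THEOREM**: the block map of the triangle host at any inputs is mine-3's triangle map. -/
theorem blockMap_tri (w : Unit ⊕ Unit → Vec6) :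
    blockMap tri triExit 0 w = thetaTri (w (Sum.inl ())) (w (Sum.inr ())) := by
  rw [← blockMap_reindex tri triExit 0 boolEquivSum w, triExit_comp, blockMap_ex2,
    Fintype.sum_equiv fin3Equiv _ (fun p => contrib ((w ∘ boolEquivSum) false) ((w ∘ boolEquivSum) true)
      (tri.Mg 0 1 (fin3Equiv.symm p)) (tri.Rd 0 1 (fin3Equiv.symm p)) (tri.Mg 0 2 (fin3Equiv.symm p))
      (tri.Rd 0 2 (fin3Equiv.symm p)) (tri.Mg 1 2 (fin3Equiv.symm p))) (fun ω => by rw [Equiv.symm_apply_apply])]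
  simp only [Fintype.sum_prod_type, Fintype.sum_bool, fin3Equiv_symm_apply, tri_Mg_01, tri_Mg_02, tri_Mg_12,
    tri_Rd_01, tri_Rd_02, Bool.true_eq_false, Bool.false_eq_true, or_false, false_or, or_true, true_or,
    and_false, and_true]
  simp only [contrib, exitOf, if_true, if_false, thetaTri, triCol, Fintype.sum_bool, Function.comp_apply,
    boolEquivSum_false, boolEquivSum_true]

/-- **The two formulations of the open core are one statement**: CONJECTURE (BLOCK MAP) for the triangle host
⟺ `θ_△` maps cone × cone into the cone. -/
theorem coneHost_tri_iff :
    ConeHost tri triExit 0 ↔ ∀ X Y : Vec6, InCone X → InCone Y → InCone (thetaTri X Y) := by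
  constructor
  · intro h X Y hX hY
    have := h (Sum.elim (fun _ => X) fun _ => Y) (fun k => by rcases k with ⟨⟩ | ⟨⟩ <;> assumption)
    rwa [blockMap_tri] at this
  · intro h w hw
    rw [blockMap_tri]
    exact h _ _ (hw _) (hw _)

/-- **The open core is the seed statement on pure inputs**: CONJECTURE (BLOCK MAP) for the triangle host ⟺
`θ_△ (V a) (V b)` lies in the cone for all pure inputs (mine-3's reduction `InCone_thetaTri_of_pure` for the
converse). -/
theorem coneHost_tri_iff_pure :
    ConeHost tri triExit 0 ↔ ∀ {m m' : ℕ} (a : Fin m → ℝ) (b : Fin m' → ℝ), (∀ i, 0 ≤ a i ∧ a i ≤ 1) →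
      (∀ j, 0 ≤ b j ∧ b j ≤ 1) → InCone (thetaTri (V a) (V b)) := by
  rw [coneHost_tri_iff]
  constructor
  · intro h m m' a b ha hb
    exact h _ _ (InCone.pure a ha) (InCone.pure b hb)
  · intro h X Y hX hY
    exact RelaxedTriangle.InCone_thetaTri_of_pure h hX hY

/-- **CONJECTURE (BLOCK MAP) for every two-exit cycle follows from the cone form of the triangle map.** -/
theorem coneHost_cycle_of_thetaTri (h : ∀ X Y : Vec6, InCone X → InCone Y → InCone (thetaTri X Y))
    (n₁ n₂ n₃ : ℕ) : ConeHost (cyc n₁ n₂ n₃) (cycExit n₁ n₂ n₃) (cycAnchor n₁ n₂ n₃) :=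
  coneHost_cycle_of_tri (coneHost_tri_iff.2 h) n₁ n₂ n₃

/-- **THE SEED PROGRAMME'S TARGET GIVES EVERY CYCLE**: if `θ_△ (V a) (V b)` lies in the cone for all pure
inputs (mine-3's statement of record), every two-exit cycle host is a cone host. -/
theorem coneHost_cycle_of_thetaTri_pure
    (h : ∀ {m m' : ℕ} (a : Fin m → ℝ) (b : Fin m' → ℝ), (∀ i, 0 ≤ a i ∧ a i ≤ 1) → (∀ j, 0 ≤ b j ∧ b j ≤ 1) →
      InCone (thetaTri (V a) (V b))) (n₁ n₂ n₃ : ℕ) :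
    ConeHost (cyc n₁ n₂ n₃) (cycExit n₁ n₂ n₃) (cycAnchor n₁ n₂ n₃) :=
  coneHost_cycle_of_thetaTri (fun _ _ hX hY => RelaxedTriangle.InCone_thetaTri_of_pure h hX hY) n₁ n₂ n₃

/-! ## The six-vector of two zones hung at the exits of a cycle -/

/-- **The zone form**: two cone zones hung at the exits of any cycle give a cone zone at the anchor, as soon as
`θ_△ (V a) (V b)` lies in the cone for all pure inputs. -/
theorem inCone_sixVec_hang_cycle_of_pure
    (h : ∀ {m m' : ℕ} (a : Fin m → ℝ) (b : Fin m' → ℝ), (∀ i, 0 ≤ a i ∧ a i ≤ 1) → (∀ j, 0 ≤ b j ∧ b j ≤ 1) →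
      InCone (thetaTri (V a) (V b))) (n₁ n₂ n₃ : ℕ) {V E T₁ T₂ : Unit ⊕ Unit → Type}
    (Z : (k : Unit ⊕ Unit) → ZoneData (V k) (E k) (T₁ k) (T₂ k)) (a : (k : Unit ⊕ Unit) → V k)
    [∀ k, Fintype (E k)] [∀ k, DecidableEq (E k)] [∀ k, Fintype (T₁ k)] [∀ k, DecidableEq (T₁ k)]
    [∀ k, Fintype (T₂ k)] [∀ k, DecidableEq (T₂ k)] (hZ : ∀ k, InCone ((Z k).sixVec (a k))) :
    InCone ((hang (cyc n₁ n₂ n₃) (cycExit n₁ n₂ n₃) Z a).sixVec (Sum.inl (cycAnchor n₁ n₂ n₃))) := by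
  rw [sixVec_hang_eq_blockMap]
  exact coneHost_cycle_of_thetaTri_pure h n₁ n₂ n₃ _ hZ

end MultiExit

end ZoneZ

end PercRepro
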